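import Summits.Ventures.CertifiedArithmetic.Statement
import Summits.Ventures.CertifiedArithmetic.LowPrec.EnvelopesE3M2
import Summits.Ventures.CertifiedArithmetic.LowPrec.EnvelopesE2M3
import Summits.Ventures.CertifiedArithmetic.LowPrec.AccumulateSharp
import Summits.Ventures.CertifiedArithmetic.LowPrec.ExactWideFP6FP4
import Summits.Ventures.CertifiedArithmetic.LowPrec.OptSSEInstances
import Summits.Ventures.CertifiedArithmetic.LowPrec.FormatsP3109
import Summits.Ventures.CertifiedArithmetic.LowPrec.OptSSEWindow
import Summits.Ventures.CertifiedArithmetic.LowPrec.OptInt8Minimax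
import Summits.Ventures.CertifiedArithmetic.LowPrec.OptInt8Window
import Summits.Ventures.CertifiedArithmetic.LowPrec.CompensatedSum
import Summits.Ventures.CertifiedArithmetic.LowPrec.AccumulateDirected

/-!
# Rung status: which venture-statement Props are already theorems

HONEST FRAMING (venture CertifiedArithmetic / cell `pub-lowprec`): certified error envelopes and
provably optimal rounding/accumulation schemes for low-precision formats under stated cost models;
every table by two implementations; no hardware or vendor claims.

Each `…_holds` below inhabits a Prop of `Summits/Ventures/CertifiedArithmetic/Statement.lean` by a
landed theorem (no new mathematics here); negative instances are recorded as `¬ …`.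
-/

namespace Summit.Ventures.CertifiedArithmetic

open Literature.ComputerArithmetic.FloatingPoint
open Literature.ComputerArithmetic.FloatingPoint.MiniFloat
open Literature.ComputerArithmetic.FloatingPoint.Format

/-- R1 structural absolute envelope: PROVED for every format. -/
theorem R1_AbsEnvelope_holds (φ : Format) : R1_AbsEnvelope φ :=
  fun _ h => abs_sub_roundNE_le_half_ulp_result h

/-- R1 structural sharp relative envelope: PROVED for every format. -/
theorem R1_RelEnvelope_holds (φ : Format) : R1_RelEnvelope φ :=
  fun _ h1 h2 => abs_sub_roundNE_le_sharp h1 h2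

/-- R1 exhaustive table envelope, FP4 `E2M1`: PROVED (kernel). -/
theorem R1_TableEnvelope_E2M1 :
    R1_TableEnvelope E2M1 [1/4, 1/4, 1/4, 1/2] [0, 0, 1/2, 1] (1 / 5) :=
  ⟨E2M1_mul_abs_envelope, E2M1_add_abs_envelope, E2M1_add_rel_envelope⟩

/-- R1 exhaustive table envelope, FP6 `E3M2`: PROVED (kernel). -/
theorem R1_TableEnvelope_E3M2 :
    R1_TableEnvelope E3M2 [1/32, 1/32, 1/16, 1/8, 1/4, 1/2, 1, 2]
      [0, 0, 1/16, 1/8, 1/4, 1/2, 1, 2] (1 / 9) :=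
  ⟨E3M2_mul_abs_envelope, E3M2_add_abs_envelope, E3M2_add_rel_envelope⟩

/-- R1 exhaustive table envelope, FP6 `E2M3`: PROVED (kernel). -/
theorem R1_TableEnvelope_E2M3 :
    R1_TableEnvelope E2M3 [1/16, 1/16, 1/8, 1/4] [0, 0, 1/8, 1/4] (1 / 17) :=
  ⟨E2M3_mul_abs_envelope, E2M3_add_abs_envelope, E2M3_add_rel_envelope⟩

/-- R2 product stage, FP8 into bfloat16 / binary32: PROVED. -/
theorem R2_ExactProducts_FP8 :
    R2_ExactProducts E4M3 E4M3 BFloat16 ∧ R2_ExactProducts E4M3 E4M3 Binary32 ∧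
    R2_ExactProducts E5M2 E5M2 BFloat16 ∧ R2_ExactProducts E5M2 E5M2 Binary32 ∧
    R2_ExactProducts E4M3 E5M2 BFloat16 ∧ R2_ExactProducts E4M3 E5M2 Binary32 :=
  ⟨E4M3_mul_E4M3_exact_in_BFloat16, E4M3_mul_E4M3_exact_in_Binary32,
   E5M2_mul_E5M2_exact_in_BFloat16, E5M2_mul_E5M2_exact_in_Binary32,
   E4M3_mul_E5M2_exact_in_BFloat16, E4M3_mul_E5M2_exact_in_Binary32⟩

/-- R2 product stage, FP4 into E4M3 and FP6 into binary16: PROVED. -/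
theorem R2_ExactProducts_FP4_FP6 :
    R2_ExactProducts E2M1 E2M1 E4M3 ∧ R2_ExactProducts E3M2 E3M2 Binary16 ∧
    R2_ExactProducts E2M3 E2M3 Binary16 ∧ R2_ExactProducts E2M3 E3M2 Binary16 :=
  ⟨E2M1_mul_E2M1_exact_in_E4M3, E3M2_mul_E3M2_exact_in_Binary16,
   E2M3_mul_E2M3_exact_in_Binary16, E2M3_mul_E3M2_exact_in_Binary16⟩

/-- R2 product stage, FP8 into binary16: REFUTED (overflow for E4M3², underflow for E5M2²). -/
theorem not_R2_ExactProducts_FP8_Binary16 :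
    ¬ R2_ExactProducts E4M3 E4M3 Binary16 ∧ ¬ R2_ExactProducts E5M2 E5M2 Binary16 :=
  ⟨E4M3_mul_E4M3_not_exact_in_Binary16, E5M2_mul_E5M2_not_exact_in_Binary16⟩

/-- R2 sequential accumulation bound: PROVED for every accumulator format with `emaxCode ≥ 2`
(in particular bfloat16, binary16, binary32). -/
theorem R2_SeqSumBound_holds (α : Format) (hα : 2 ≤ α.emaxCode) : R2_SeqSumBound α :=
  fun x n hx hr => abs_seqSum_sub_sum_le hα x n hx hr

/-- The three accumulator formats satisfy the side condition `emaxCode ≥ 2`. -/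
theorem R2_SeqSumBound_accumulators :
    R2_SeqSumBound Binary16 ∧ R2_SeqSumBound BFloat16 ∧ R2_SeqSumBound Binary32 :=
  ⟨R2_SeqSumBound_holds _ (by decide), R2_SeqSumBound_holds _ (by decide),
   R2_SeqSumBound_holds _ (by decide)⟩

/-- R3 one-step SR mean/variance: PROVED for every format. -/
theorem R3_SROneStep_holds (φ : Format) : R3_SROneStep φ :=
  fun _ h => ⟨srMean_format h, srVar_format h⟩

/-- R3 SR summation unbiased absent saturation: PROVED (sr seat's `accExp_id_of_noSat`). -/
theorem R3_SRSumUnbiased_holds (φ : Format) : R3_SRSumUnbiased φ :=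
  fun x n s h => LowPrec.SR.accExp_id_of_noSat _ x n s h

/-! ### R2 — any evaluation order, sharp constant (appended 2026-08-19T23:10Z) -/

/-- R2 any-order sharp bound `(n-1)·u/(1+u)·Σ|xᵢ|` (Jeannerod–Rump 2018 Thm 4.1 constant, every
binary evaluation tree, no restriction on `n`): PROVED for every accumulator format with
`emaxCode ≥ 2` by `MiniFloat.abs_eval_sub_exact_le_sharp` (AccumulateSharp.lean). -/
theorem R2_AnyOrderSharp_holds (α : Format) (hα : 2 ≤ α.emaxCode) : R2_AnyOrderSharp α :=
  fun t ht => by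
    simpa [Literature.ComputerArithmetic.JeannerodRump2018.SumTree.absSum] using
      MiniFloat.abs_eval_sub_exact_le_sharp hα t ht

/-- The three accumulator formats satisfy the any-order sharp bound. -/
theorem R2_AnyOrderSharp_accumulators :
    R2_AnyOrderSharp Binary16 ∧ R2_AnyOrderSharp BFloat16 ∧ R2_AnyOrderSharp Binary32 :=
  ⟨R2_AnyOrderSharp_holds _ (by decide), R2_AnyOrderSharp_holds _ (by decide),
   R2_AnyOrderSharp_holds _ (by decide)⟩

/-- The OCP 8-bit formats themselves (used as accumulators) also satisfy it. -/
theorem R2_AnyOrderSharp_FP8 : R2_AnyOrderSharp E4M3 ∧ R2_AnyOrderSharp E5M2 :=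
  ⟨R2_AnyOrderSharp_holds _ (by decide), R2_AnyOrderSharp_holds _ (by decide)⟩

/-! ### R4 — optimal schemes, part 1 (opt seat's engines; discharges verbatim from HOME
`lean/opt/R4_StatementAppend.lean`) -/

/-- R4 scale-halving engine (Lemma S1/S2, E2M1): PROVED by `LowPrec.Opt.e2m1_halving_le/_eq`
(OptScaleNesting.lean, opt seat). -/
theorem R4_ScaleHalvingE2M1_holds : R4_ScaleHalvingE2M1 :=
  ⟨fun _ hy => LowPrec.Opt.e2m1_halving_le hy, fun _ hly hyc => LowPrec.Opt.e2m1_halving_eq hly hyc⟩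

/-- R4 CM-R (SR is the minimum-variance unbiased rounding): PROVED by
`LowPrec.Opt.variance_lower_bound` (OptSRMinVariance.lean, opt seat). -/
theorem R4_SRMinVariance_holds : R4_SRMinVariance :=
  fun _ w v _ _ _ hab hw hsum hmean hgap => LowPrec.Opt.variance_lower_bound w v hab hw hsum hmean hgap

/-- R2 product stage, the remaining FP6/FP4 operand pairs (an FP4 operand) into binary16: PROVED
(`products_exact_in_Binary16`, Theorem P instances, enum seat). Together with
`R2_ExactProducts_FP4_FP6` and `R2_ExactProducts.symm` this is every ordered operand pair over
{E3M2, E2M3, E2M1} — cf. `fp6fp4_products_exact_in_Binary16`; the SUM side of R2 for FP6/FP4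
data (every sum a binary16 / binary32 value, a bfloat16 value except for E3M2 + E3M2) is the
landed `fp6fp4_sums_exact_wide` (ExactWideFP6FP4.lean), not restated here. -/
theorem R2_ExactProducts_FP6FP4_withFP4_Binary16 :
    R2_ExactProducts E3M2 E2M1 Binary16 ∧ R2_ExactProducts E2M3 E2M1 Binary16 ∧
    R2_ExactProducts E2M1 E2M1 Binary16 :=
  ⟨products_exact_in_Binary16.2.1, products_exact_in_Binary16.2.2.2.1,
   products_exact_in_Binary16.2.2.2.2⟩

/-! ### R4 — optimal schemes, part 2 (Theorems S3 / S5 / S6 for the MXFP4/MXFP6 element grids; discharges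
verbatim from the opt seat's HOME `lean/opt/R4_TwoCandidates_StatementBlock.lean.txt`) -/

/-- R4/S3 for MXFP4 (E2M1), MXFP6 (E2M3, E3M2). PROVED: `LowPrec.Opt.two_candidates_e2m1/_e2m3/_e3m2`. -/
theorem R4_TwoCandidates_holds :
    R4_TwoCandidates LowPrec.Opt.e2m1Lo LowPrec.Opt.e2m1Lo_ne 12 ∧
    R4_TwoCandidates LowPrec.Opt.e2m3Lo LowPrec.Opt.e2m3Lo_ne 60 ∧
    R4_TwoCandidates LowPrec.Opt.e3m2Lo LowPrec.Opt.e3m2Lo_ne 448 :=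
  ⟨fun _ x _ _ i₀ hs hx0 hxa ha ha' hi₀ => LowPrec.Opt.two_candidates_e2m1 x hs hx0 hxa ha ha' i₀ hi₀,
   fun _ x _ _ i₀ hs hx0 hxa ha ha' hi₀ => LowPrec.Opt.two_candidates_e2m3 x hs hx0 hxa ha ha' i₀ hi₀,
   fun _ x _ _ i₀ hs hx0 hxa ha ha' hi₀ => LowPrec.Opt.two_candidates_e3m2 x hs hx0 hxa ha ha' i₀ hi₀⟩

/-- R4/S5 (L∞) for MXFP4 (E2M1), MXFP6 (E2M3, E3M2). PROVED: `LowPrec.Opt.ceil_minimax_e2m1/_e2m3/_e3m2`. -/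
theorem R4_CeilMinimaxLinf_holds :
    R4_CeilMinimaxLinf LowPrec.Opt.e2m1Lo LowPrec.Opt.e2m1Lo_ne 12 ∧
    R4_CeilMinimaxLinf LowPrec.Opt.e2m3Lo LowPrec.Opt.e2m3Lo_ne 60 ∧
    R4_CeilMinimaxLinf LowPrec.Opt.e3m2Lo LowPrec.Opt.e3m2Lo_ne 448 :=
  ⟨fun _ x _ _ i₀ v hu hx0 hxa ha ha' hi₀ hv =>
      LowPrec.Opt.ceil_minimax_e2m1 x hu hx0 hxa (by simpa using ha) (by simpa using ha') i₀ hi₀ v hv,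
   fun _ x _ _ i₀ v hu hx0 hxa ha ha' hi₀ hv =>
      LowPrec.Opt.ceil_minimax_e2m3 x hu hx0 hxa (by simpa using ha) (by simpa using ha') i₀ hi₀ v hv,
   fun _ x _ _ i₀ v hu hx0 hxa ha ha' hi₀ hv =>
      LowPrec.Opt.ceil_minimax_e3m2 x hu hx0 hxa (by simpa using ha) (by simpa using ha') i₀ hi₀ v hv⟩

/-- R4/S6-inf for MXFP4 (E2M1), MXFP6 (E2M3, E3M2). PROVED: `LowPrec.Opt.search_gain_le_e2m1/_e2m3/_e3m2`. -/
theorem R4_SearchGainLinf_holds :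
    R4_SearchGainLinf LowPrec.Opt.e2m1Lo LowPrec.Opt.e2m1Lo_ne 12 ∧
    R4_SearchGainLinf LowPrec.Opt.e2m3Lo LowPrec.Opt.e2m3Lo_ne 60 ∧
    R4_SearchGainLinf LowPrec.Opt.e3m2Lo LowPrec.Opt.e3m2Lo_ne 448 :=
  ⟨fun _ x _ _ i₀ v hu hx0 hxa ha ha' hi₀ hv =>
      LowPrec.Opt.search_gain_le_e2m1 x hu hx0 hxa (by simpa using ha) (by simpa using ha') i₀ hi₀ v hv,
   fun _ x _ _ i₀ v hu hx0 hxa ha ha' hi₀ hv =>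
      LowPrec.Opt.search_gain_le_e2m3 x hu hx0 hxa (by simpa using ha) (by simpa using ha') i₀ hi₀ v hv,
   fun _ x _ _ i₀ v hu hx0 hxa ha ha' hi₀ hv =>
      LowPrec.Opt.search_gain_le_e3m2 x hu hx0 hxa (by simpa using ha) (by simpa using ha') i₀ hi₀ v hv⟩

/-- R4/S6 for MXFP4 (E2M1), MXFP6 (E2M3, E3M2). PROVED: `LowPrec.Opt.sse_search_gain_le_e2m1/_e2m3/_e3m2`. -/
theorem R4_SearchGainSSE_holds :
    R4_SearchGainSSE LowPrec.Opt.e2m1Lo LowPrec.Opt.e2m1Lo_ne 12 ∧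
    R4_SearchGainSSE LowPrec.Opt.e2m3Lo LowPrec.Opt.e2m3Lo_ne 60 ∧
    R4_SearchGainSSE LowPrec.Opt.e3m2Lo LowPrec.Opt.e3m2Lo_ne 448 :=
  ⟨fun _ x _ _ i₀ v hu hx0 hxa ha ha' hi₀ hv =>
      LowPrec.Opt.sse_search_gain_le_e2m1 x hu hx0 hxa (by simpa using ha) (by simpa using ha') i₀ hi₀ v hv,
   fun _ x _ _ i₀ v hu hx0 hxa ha ha' hi₀ hv =>
      LowPrec.Opt.sse_search_gain_le_e2m3 x hu hx0 hxa (by simpa using ha) (by simpa using ha') i₀ hi₀ v hv,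
   fun _ x _ _ i₀ v hu hx0 hxa ha ha' hi₀ hv =>
      LowPrec.Opt.sse_search_gain_le_e3m2 x hu hx0 hxa (by simpa using ha) (by simpa using ha') i₀ hi₀ v hv⟩

/-- R4/S6 attainment for MXFP4 (E2M1), MXFP6 (E2M3, E3M2). PROVED: `LowPrec.Opt.sse_gain_attained_e2m1/_e2m3/_e3m2`. -/
theorem R4_SearchGainSSE_attained_holds :
    R4_SearchGainSSE_attained LowPrec.Opt.e2m1Lo LowPrec.Opt.e2m1Lo_ne 12 ∧
    R4_SearchGainSSE_attained LowPrec.Opt.e2m3Lo LowPrec.Opt.e2m3Lo_ne 60 ∧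
    R4_SearchGainSSE_attained LowPrec.Opt.e3m2Lo LowPrec.Opt.e3m2Lo_ne 448 :=
  ⟨fun _ hk _ hu => by simpa using LowPrec.Opt.sse_gain_attained_e2m1 hk hu,
   fun _ hk _ hu => by simpa using LowPrec.Opt.sse_gain_attained_e2m3 hk hu,
   fun _ hk _ hu => by simpa using LowPrec.Opt.sse_gain_attained_e3m2 hk hu⟩

/-- R4/S5 (SSE) for MXFP4 (E2M1), MXFP6 (E2M3, E3M2). PROVED: `LowPrec.Opt.ceil_minimax_sse_e2m1/_e2m3/_e3m2`. -/
theorem R4_CeilMinimaxSSE_holds :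
    R4_CeilMinimaxSSE LowPrec.Opt.e2m1Lo LowPrec.Opt.e2m1Lo_ne 12 ∧
    R4_CeilMinimaxSSE LowPrec.Opt.e2m3Lo LowPrec.Opt.e2m3Lo_ne 60 ∧
    R4_CeilMinimaxSSE LowPrec.Opt.e3m2Lo LowPrec.Opt.e3m2Lo_ne 448 :=
  ⟨fun _ x _ _ i₀ v hu hx0 hxa ha ha' hi₀ hv =>
      LowPrec.Opt.ceil_minimax_sse_e2m1 x hu hx0 hxa (by simpa using ha) (by simpa using ha') i₀ hi₀ v hv,
   fun _ x _ _ i₀ v hu hx0 hxa ha ha' hi₀ hv =>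
      LowPrec.Opt.ceil_minimax_sse_e2m3 x hu hx0 hxa (by simpa using ha) (by simpa using ha') i₀ hi₀ v hv,
   fun _ x _ _ i₀ v hu hx0 hxa ha ha' hi₀ hv =>
      LowPrec.Opt.ceil_minimax_sse_e3m2 x hu hx0 hxa (by simpa using ha) (by simpa using ha') i₀ hi₀ v hv⟩

/-! ### R2 for the IEEE P3109 8-bit formats used as accumulators (FormatsP3109.lean) -/

/-- The P3109 `binary8p3/8p4/8p5` (Extended) and Finite-domain (= FNUZ) value sets satisfy the
sequential and the any-order sharp accumulation bounds (`emaxCode ≥ 2`). -/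
theorem R2_bounds_P3109 :
    (R2_SeqSumBound Binary8p3 ∧ R2_SeqSumBound Binary8p4 ∧ R2_SeqSumBound Binary8p5 ∧
      R2_SeqSumBound Binary8p3F ∧ R2_SeqSumBound Binary8p4F) ∧
    (R2_AnyOrderSharp Binary8p3 ∧ R2_AnyOrderSharp Binary8p4 ∧ R2_AnyOrderSharp Binary8p5 ∧
      R2_AnyOrderSharp Binary8p3F ∧ R2_AnyOrderSharp Binary8p4F) :=
  ⟨⟨R2_SeqSumBound_holds _ (by decide), R2_SeqSumBound_holds _ (by decide),
    R2_SeqSumBound_holds _ (by decide), R2_SeqSumBound_holds _ (by decide),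
    R2_SeqSumBound_holds _ (by decide)⟩,
   ⟨R2_AnyOrderSharp_holds _ (by decide), R2_AnyOrderSharp_holds _ (by decide),
    R2_AnyOrderSharp_holds _ (by decide), R2_AnyOrderSharp_holds _ (by decide),
    R2_AnyOrderSharp_holds _ (by decide)⟩⟩

/-! ### R4 part 3 (opt seat, gen 3): Theorem S4 (SSE window threshold) and the MXINT8-type uniform grid -/

/-- R4/S4 for MXFP4 (E2M1), MXFP6 (E2M3, E3M2) and the uniform MXINT8-type grid. PROVED: `LowPrec.Opt.sse_two_candidates_e2m1/_e2m3/_e3m2/_int8`. -/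
theorem R4_SSETwoCandidates_holds :
    R4_SSETwoCandidates LowPrec.Opt.e2m1Lo LowPrec.Opt.e2m1Lo_ne 12 ∧
    R4_SSETwoCandidates LowPrec.Opt.e2m3Lo LowPrec.Opt.e2m3Lo_ne 60 ∧
    R4_SSETwoCandidates LowPrec.Opt.e3m2Lo LowPrec.Opt.e3m2Lo_ne 448 ∧
    R4_SSETwoCandidates LowPrec.Opt.int8 LowPrec.Opt.int8_ne 127 :=
  ⟨fun _ hk x _ _ i₀ v hu hx0 hxa ha ha' hi₀ hv =>
      LowPrec.Opt.sse_two_candidates_e2m1 x hu hx0 hxa (by simpa using ha) (by simpa using ha') i₀ hi₀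
        (by simpa using hk) v hv,
   fun _ hk x _ _ i₀ v hu hx0 hxa ha ha' hi₀ hv =>
      LowPrec.Opt.sse_two_candidates_e2m3 x hu hx0 hxa (by simpa using ha) (by simpa using ha') i₀ hi₀
        (by simpa using hk) v hv,
   fun _ hk x _ _ i₀ v hu hx0 hxa ha ha' hi₀ hv =>
      LowPrec.Opt.sse_two_candidates_e3m2 x hu hx0 hxa (by simpa using ha) (by simpa using ha') i₀ hi₀
        (by simpa using hk) v hv,
   fun _ hk x _ _ i₀ v hu hx0 hxa ha ha' hi₀ hv =>
      LowPrec.Opt.sse_two_candidates_int8 x hu hx0 hxa (by simpa using ha) (by simpa using ha') i₀ hi₀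
        (by simpa using hk) v hv⟩

/-- R4/S4 tightness for E2M1, E2M3, E3M2 and the uniform grid. PROVED: `LowPrec.Opt.sse_third_scale_wins_e2m1/_e2m3/_e3m2/_int8`. -/
theorem R4_SSEThirdScaleWins_holds :
    R4_SSEThirdScaleWins LowPrec.Opt.e2m1Lo LowPrec.Opt.e2m1Lo_ne 12 ∧
    R4_SSEThirdScaleWins LowPrec.Opt.e2m3Lo LowPrec.Opt.e2m3Lo_ne 60 ∧
    R4_SSEThirdScaleWins LowPrec.Opt.e3m2Lo LowPrec.Opt.e3m2Lo_ne 448 ∧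
    R4_SSEThirdScaleWins LowPrec.Opt.int8 LowPrec.Opt.int8_ne 127 :=
  ⟨fun _ hk _ hu => by simpa using LowPrec.Opt.sse_third_scale_wins_e2m1 (by simpa using hk) hu,
   fun _ hk _ hu => by simpa using LowPrec.Opt.sse_third_scale_wins_e2m3 (by simpa using hk) hu,
   fun _ hk _ hu => by simpa using LowPrec.Opt.sse_third_scale_wins_e3m2 (by simpa using hk) hu,
   fun _ hk _ hu => by simpa using LowPrec.Opt.sse_third_scale_wins_int8 (by simpa using hk) hu⟩

/-- R4/S9(iii) (L∞) for the uniform grid. PROVED: `LowPrec.Opt.int8_*` (OptInt8Minimax.lean). -/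
theorem R4_Int8FloorMinimax_holds : R4_Int8FloorMinimax :=
  ⟨fun _ x _ _ i₀ hu hx0 hxa ha => LowPrec.Opt.int8_half_blockErr_lt x hu hx0 hxa ha i₀,
   fun _ _ hu => LowPrec.Opt.int8_ceil_blockErr_ge hu,
   fun _ x _ _ i₀ hu hx0 hxa ha ha' hi₀ => LowPrec.Opt.int8_ceil_le_half_of_ge x hu hx0 hxa ha ha' i₀ hi₀⟩

/-- R4/S3 for the uniform MXINT8-type grid `{0,…,127}` (fourth instance of `R4_TwoCandidates`).
PROVED: `LowPrec.Opt.two_candidates_int8` (OptInt8Window.lean). -/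
theorem R4_TwoCandidates_int8_holds : R4_TwoCandidates LowPrec.Opt.int8 LowPrec.Opt.int8_ne 127 :=
  fun _ x _ _ i₀ hs hx0 hxa ha ha' hi₀ => LowPrec.Opt.two_candidates_int8 x hs hx0 hxa ha ha' i₀ hi₀

/-- R4/T3(a) chain 1, every tree shape. PROVED: `LowPrec.Opt.t3_chain1_ratio` (OptTreeChain.lean). -/
theorem R4_TreeChainLowerBound_holds : R4_TreeChainLowerBound :=
  fun t ht => ⟨LowPrec.Opt.chain1 t, LowPrec.Opt.t3_chain1_ratio t ht⟩


/-! ### R2 — compensated and truncated accumulation (lean seat gen 2, 2026-08-20) -/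

/-- R2 compensated (Neumaier/`kbn`) envelope: PROVED for every format with `emaxCode ≥ 2` by
`MiniFloat.abs_kbnSum_sub_sum_le` (CompensatedSum.lean). -/
theorem R2_CompensatedSum_holds (α : Format) (hα : 2 ≤ α.emaxCode) : R2_CompensatedSum α :=
  fun x n hx hr1 hr2 hr3 => MiniFloat.abs_kbnSum_sub_sum_le hα x n hx hr1 hr2 hr3

/-- The three accumulator formats and the two OCP 8-bit formats satisfy the compensated envelope. -/
theorem R2_CompensatedSum_accumulators :
    R2_CompensatedSum Binary16 ∧ R2_CompensatedSum BFloat16 ∧ R2_CompensatedSum Binary32 ∧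
    R2_CompensatedSum E4M3 ∧ R2_CompensatedSum E5M2 :=
  ⟨R2_CompensatedSum_holds _ (by decide), R2_CompensatedSum_holds _ (by decide),
   R2_CompensatedSum_holds _ (by decide), R2_CompensatedSum_holds _ (by decide),
   R2_CompensatedSum_holds _ (by decide)⟩

/-- R2 truncated (round-toward-zero) accumulation in any order: PROVED for EVERY format by
`MiniFloat.abs_eval_rz_sub_exact_le` / `…_height` (AccumulateDirected.lean). -/
theorem R2_TruncatedAnyOrder_holds (α : Format) : R2_TruncatedAnyOrder α :=
  fun t ht hS =>
    ⟨by simpa [Literature.ComputerArithmetic.JeannerodRump2018.SumTree.absSum] using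
        MiniFloat.abs_eval_rz_sub_exact_le t ht
          (by simpa [Literature.ComputerArithmetic.JeannerodRump2018.SumTree.absSum] using hS),
     by simpa [Literature.ComputerArithmetic.JeannerodRump2018.SumTree.absSum] using
        MiniFloat.abs_eval_rz_sub_exact_le_height t ht
          (by simpa [Literature.ComputerArithmetic.JeannerodRump2018.SumTree.absSum] using hS)⟩

end Summit.Ventures.CertifiedArithmetic
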